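import Mathlib
import Literature.AlgebraicGeometry.Resolution.TranscendenceDefect
import Literature.AlgebraicGeometry.Resolution.LocalBlowup
import Summits.ResolutionOfSingularities.ResolutionOfSingularities.Theorems.RadicialJungCleanModelsDimNonDiscreteConeNarrowed
import Summits.ResolutionOfSingularities.ResolutionOfSingularities.Theorems.RadicialJungCleanModelsKK05AbhyankarColumnHolds
import HarnessLib

/-!
# Route `RadicialJung`, crux `CleanModels` (stmt-15917), line `Sketch` rev 35, stub 7 `stub_cleanModelsDimGEFour`: the reduction of record with the
# Abhyankar column cut down to its GENUINELY OPEN corner (Knaf–Kuhlmann 2005 Thm. 1.1, general form, DISCHARGED)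

Explicit-unit seat `decomp-res-hand-1` g4 (hand 1, «direct: discharge printed inputs by name»).  OURS; nothing here proves resolution of singularities in
characteristic `p`.

hand-2 g3's reduction of record ✓ `cleanModelsDimGEFour_of_localMonomializationRes` asks the local-uniformization-with-monomialization input `hMonoRes_d`
at every zero-dimensional valuation ring `O` that is NOT «Abhyankar with residue field separable ALGEBRAIC over `k`».  With the general form of
Knaf–Kuhlmann's theorem discharged (✓ `KK05ValueBasis.knafKuhlmann2005_Thm11_monomialFormSepGen_holds`, this seat) and hand-2 g3's ground-field descent
(✓ `…_of_subfield`, ✓ `…_of_perfectSubfield`, unconditional as ✓ `KK05ValueBasis.…_holds`), the input is needed only at `O` that is NOT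
«Abhyankar with (`κ(O)/k` separably generated OR `k` finitely generated over a perfect subfield)»:

* `localMonomialization_dim_of_resSG d` — `hMono_d ⟸ hMonoResSG_d` (every ground field), UNCONDITIONAL.
* `cleanModelsDimGEFour_of_localMonomializationResSG` — **the registered stub `stub_cleanModelsDimGEFour` VERBATIM ⟸ `hMonoResSG_d ∧ hNDcone_d ∧ hZ_d`
  (`d ≥ 4`)**.  Remaining content of `hMonoResSG_d`: local uniformization with monomialization in dimension `d` at zero-dimensional valuations that are
  non-Abhyankar (open for `d ≥ 4`, Cutkosky–Mourtada 2019 Def. 1.2), or Abhyankar with `κ(O)/k` not separably generated over a ground field `k` that is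
  NOT finitely generated over any perfect subfield (not in print: Temkin 2013 extends `K`).  `hNDcone_d` (class (B) in dimension `d`) and `hZ_d` (Piltant
  patching for `P_clean`) unchanged.  No printed hypothesis in the reduction of stub 7.

Structural bookkeeping, counted 0.
-/

noncomputable section

set_option linter.dupNamespace false -- mandated namespace of this single-conjunct summit

open IsLocalRing AlgebraicGeometry CategoryTheory
open Literature.AlgebraicGeometry.Resolution Literature.AlgebraicGeometry.Motives

namespace Summit.ResolutionOfSingularities.ResolutionOfSingularities.Theorems.RadicialJung.CleanModels

/-- **`hMono_d ⟸ hMonoResSG_d`, UNCONDITIONAL, every ground field**: local monomialization in dimension `d` need only be ASSUMED at zero-dimensional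
valuations that are NOT «Abhyankar with (residue field separably generated over `k`, or `k` finitely generated over a perfect subfield)»; at those it is
Knaf–Kuhlmann's Thm. 1.1 in its general form (✓ discharged) through hand-2 g3's ground-field descent. [cite: KnafKuhlmann2005, Thm. 1.1 and Cor. 2.2] -/
theorem localMonomialization_dim_of_resSG (d : ℕ)
    (hMonoResSG : ∀ (k : Type) [Field k] (K : Type) [Field K] [Algebra k K]
    (O : ValuationSubring K) (A : Subalgebra k K), A.toSubring ≤ O.toSubring → A.FG → IsFractionRing A K →
    ringKrullDim A ≤ (d : WithBot ℕ∞) → IsRegularLocalRing (locAtCentre A.toSubring O) →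
    ringKrullDim (locAtCentre A.toSubring O) = (d : WithBot ℕ∞) →
    (∀ (T : Subring K) (hT : T ≤ O.toSubring), A.toSubring ≤ T → (subringCentre T O hT).IsMaximal) →
    (∀ hk : ∀ c : k, algebraMap k K c ∈ O, ¬ (transcendenceDefect k O hk = 0 ∧
      ((letI : Algebra k (ResidueField O) := ((IsLocalRing.residue O).comp ((algebraMap k K).codRestrict O hk)).toAlgebra
        ∃ s : Finset (ResidueField O), IsTranscendenceBasis k ((↑) : s → ResidueField O) ∧
          Algebra.IsSeparable (IntermediateField.adjoin k (s : Set (ResidueField O))) (ResidueField O)) ∨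
       (∃ (k₀ : Subfield k) (_ : PerfectField k₀) (T : Finset k), IntermediateField.adjoin k₀ (T : Set k) = ⊤)))) →
    ∀ Z : Finset K, (∀ z ∈ Z, z ∈ A) →
    ∃ (A' : Subalgebra k K), A'.toSubring ≤ O.toSubring ∧ A ≤ A' ∧ A'.FG ∧
    ∃ (_ : IsRegularLocalRing (locAtCentre A'.toSubring O)) (e : ℕ) (a : Fin e → ↥(locAtCentre A'.toSubring O)),
      Ideal.span (Set.range a) = IsLocalRing.maximalIdeal ↥(locAtCentre A'.toSubring O) ∧
      ringKrullDim ↥(locAtCentre A'.toSubring O) = (e : WithBot ℕ∞) ∧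
      ∀ z ∈ Z, z ≠ 0 → ∃ (v : ↥(locAtCentre A'.toSubring O)) (μ : Fin e → ℕ), IsUnit v ∧
        z = (v : K) * ∏ i, ((a i : ↥(locAtCentre A'.toSubring O)) : K) ^ (μ i)) :
    ∀ (k : Type) [Field k] (K : Type) [Field K] [Algebra k K]
    (O : ValuationSubring K) (A : Subalgebra k K), A.toSubring ≤ O.toSubring → A.FG → IsFractionRing A K →
    ringKrullDim A ≤ (d : WithBot ℕ∞) → IsRegularLocalRing (locAtCentre A.toSubring O) →
    ringKrullDim (locAtCentre A.toSubring O) = (d : WithBot ℕ∞) →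
    (∀ (T : Subring K) (hT : T ≤ O.toSubring), A.toSubring ≤ T → (subringCentre T O hT).IsMaximal) →
    ∀ Z : Finset K, (∀ z ∈ Z, z ∈ A) →
    ∃ (A' : Subalgebra k K), A'.toSubring ≤ O.toSubring ∧ A ≤ A' ∧ A'.FG ∧
    ∃ (_ : IsRegularLocalRing (locAtCentre A'.toSubring O)) (e : ℕ) (a : Fin e → ↥(locAtCentre A'.toSubring O)),
      Ideal.span (Set.range a) = IsLocalRing.maximalIdeal ↥(locAtCentre A'.toSubring O) ∧
      ringKrullDim ↥(locAtCentre A'.toSubring O) = (e : WithBot ℕ∞) ∧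
      ∀ z ∈ Z, z ≠ 0 → ∃ (v : ↥(locAtCentre A'.toSubring O)) (μ : Fin e → ℕ), IsUnit v ∧
        z = (v : K) * ∏ i, ((a i : ↥(locAtCentre A'.toSubring O)) : K) ^ (μ i) := by
  intro k _ K _ _ O A hAO hAfg hfrac hdimA hreg hdim hzd Z hZ
  classical
  have hk : ∀ c : k, algebraMap k K c ∈ O := fun c => hAO (A.algebraMap_mem c)
  by_cases hgood : transcendenceDefect k O hk = 0 ∧
      ((letI : Algebra k (ResidueField O) := ((IsLocalRing.residue O).comp ((algebraMap k K).codRestrict O hk)).toAlgebra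
        ∃ s : Finset (ResidueField O), IsTranscendenceBasis k ((↑) : s → ResidueField O) ∧
          Algebra.IsSeparable (IntermediateField.adjoin k (s : Set (ResidueField O))) (ResidueField O)) ∨
       (∃ (k₀ : Subfield k) (_ : PerfectField k₀) (T : Finset k), IntermediateField.adjoin k₀ (T : Set k) = ⊤))
  · obtain ⟨htd, hsg | ⟨k₀, hperf, T, hT⟩⟩ := hgood
    · -- residue field separably generated over `k` itself: the discharged general form with `k₀ = k`, `T = ∅`
      have hT : IntermediateField.adjoin k ((∅ : Finset k) : Set k) = ⊤ := by
        rw [Finset.coe_empty, IntermediateField.adjoin_empty]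
        exact eq_top_iff.mpr fun x _ => IntermediateField.mem_bot.mpr ⟨x, rfl⟩
      exact KK05ValueBasis.localMonomialization_at_abhyankarPlace_of_subfield_holds k k K ∅ hT O A hAO hAfg hfrac hk htd hsg Z hZ
    · -- `k` finitely generated over a perfect subfield `k₀`
      haveI : PerfectField k₀ := hperf
      exact KK05ValueBasis.localMonomialization_at_abhyankarPlace_of_perfectSubfield_holds k₀ k K T hT O A hAO hAfg hfrac hk htd Z hZ
  · exact hMonoResSG k K O A hAO hAfg hfrac hdimA hreg hdim hzd (fun _ => hgood) Z hZ

/-- **The frontier stub `stub_cleanModelsDimGEFour` (statement VERBATIM) ⟸ `hMonoResSG_d ∧ hNDcone_d ∧ hZ_d` for every `d ≥ 4` — no printed hypothesis,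
Abhyankar column cut to its open corner.**  ✓ `cleanModelsDimGEFour_of_localMonomialization_coneNarrowed` with `hMono_d` supplied by
`localMonomialization_dim_of_resSG`.  The three inputs are OPEN/RESEARCH in dimension `≥ 4` (module docstring); structural reduction only.
[cite: KnafKuhlmann2005, Thm. 1.1] [cite: Piltant2013, Cor. 5.7 and p. 2] [cite: CutkoskyMourtada2019, Def. 1.2] -/
theorem cleanModelsDimGEFour_of_localMonomializationResSG
    (hMonoResSG : ∀ d : ℕ, 4 ≤ d → ∀ (k : Type) [Field k] (K : Type) [Field K] [Algebra k K]
    (O : ValuationSubring K) (A : Subalgebra k K), A.toSubring ≤ O.toSubring → A.FG → IsFractionRing A K →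
    ringKrullDim A ≤ (d : WithBot ℕ∞) → IsRegularLocalRing (locAtCentre A.toSubring O) →
    ringKrullDim (locAtCentre A.toSubring O) = (d : WithBot ℕ∞) →
    (∀ (T : Subring K) (hT : T ≤ O.toSubring), A.toSubring ≤ T → (subringCentre T O hT).IsMaximal) →
    (∀ hk : ∀ c : k, algebraMap k K c ∈ O, ¬ (transcendenceDefect k O hk = 0 ∧
      ((letI : Algebra k (ResidueField O) := ((IsLocalRing.residue O).comp ((algebraMap k K).codRestrict O hk)).toAlgebra
        ∃ s : Finset (ResidueField O), IsTranscendenceBasis k ((↑) : s → ResidueField O) ∧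
          Algebra.IsSeparable (IntermediateField.adjoin k (s : Set (ResidueField O))) (ResidueField O)) ∨
       (∃ (k₀ : Subfield k) (_ : PerfectField k₀) (T : Finset k), IntermediateField.adjoin k₀ (T : Set k) = ⊤)))) →
    ∀ Z : Finset K, (∀ z ∈ Z, z ∈ A) →
    ∃ (A' : Subalgebra k K), A'.toSubring ≤ O.toSubring ∧ A ≤ A' ∧ A'.FG ∧
    ∃ (_ : IsRegularLocalRing (locAtCentre A'.toSubring O)) (e : ℕ) (a : Fin e → ↥(locAtCentre A'.toSubring O)),
      Ideal.span (Set.range a) = IsLocalRing.maximalIdeal ↥(locAtCentre A'.toSubring O) ∧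
      ringKrullDim ↥(locAtCentre A'.toSubring O) = (e : WithBot ℕ∞) ∧
      ∀ z ∈ Z, z ≠ 0 → ∃ (v : ↥(locAtCentre A'.toSubring O)) (μ : Fin e → ℕ), IsUnit v ∧
        z = (v : K) * ∏ i, ((a i : ↥(locAtCentre A'.toSubring O)) : K) ^ (μ i))
    (hND' : ∀ d : ℕ, 4 ≤ d → ∀ (p : ℕ), p.Prime →
    ∀ (k : Type) [Field k] [CharP k p] (K : Type) [Field K] [Algebra k K]
    (O : ValuationSubring K) (A : Subalgebra k K), A.toSubring ≤ O.toSubring → A.FG → IsFractionRing A K →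
    ringKrullDim A ≤ (d : WithBot ℕ∞) → IsRegularLocalRing (locAtCentre A.toSubring O) →
    ringKrullDim (locAtCentre A.toSubring O) = (d : WithBot ℕ∞) →
    (∀ (T : Subring K) (hT : T ≤ O.toSubring), A.toSubring ≤ T → (subringCentre T O hT).IsMaximal) →
    ∀ g₀ : K, (∀ c : K, c ^ p ≠ g₀) →
    (∀ f₀ : K, ∃ f₁ : K, O.valuation (g₀ - f₁ ^ p) < O.valuation (g₀ - f₀ ^ p)) →
    (∀ hk : ∀ c : k, algebraMap k K c ∈ O, transcendenceDefect k O hk ≠ 0) →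
    ¬ (∃ π : K, π ≠ 0 ∧ (∀ x : K, O.valuation x < 1 → O.valuation x ≤ O.valuation π) ∧
      (∀ x : K, x ≠ 0 → ∃ n : ℕ, O.valuation π ^ n ≤ O.valuation x)) →
    ¬ (∃ (A' : Subalgebra k K) (_ : A'.toSubring ≤ O.toSubring) (_ : A ≤ A') (_ : A'.FG)
      (_ : IsRegularLocalRing (locAtCentre A'.toSubring O)) (c : Fin p → K) (_ : ∃ j : Fin p, (j : ℕ) ≠ 0 ∧ c j ≠ 0)
      (h : ↥(locAtCentre A'.toSubring O)) (_ : (∑ j : Fin p, c j ^ p * g₀ ^ (j : ℕ)) = (h : K))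
      (d : ℕ) (_ : 0 < d) (_ : (IsLocalRing.maximalIdeal ↥(locAtCentre A'.toSubring O)).spanFinrank = d)
      (t : Fin d → ↥(locAtCentre A'.toSubring O))
      (_ : Ideal.span (Set.range t) = IsLocalRing.maximalIdeal ↥(locAtCentre A'.toSubring O))
      (F : MvPolynomial (Fin d) ↥(locAtCentre A'.toSubring O)) (e N : ℕ) (_ : F.IsHomogeneous e) (_ : ¬ p ∣ e) (_ : e ≤ N + 1),
      h - MvPolynomial.aeval t F ∈ IsLocalRing.maximalIdeal ↥(locAtCentre A'.toSubring O) ^ (e + 1) ∧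
      ∀ i, ∃ b : Fin d → ↥(locAtCentre A'.toSubring O),
        (∀ l, b l ∈ IsLocalRing.maximalIdeal ↥(locAtCentre A'.toSubring O) ^ (N + 1 - e)) ∧
        t i ^ N - ∑ l, b l * MvPolynomial.aeval t (MvPolynomial.pderiv l F) ∈
          IsLocalRing.maximalIdeal ↥(locAtCentre A'.toSubring O) ^ (N + 1)) →
    ∃ (A' : Subalgebra k K), A'.toSubring ≤ O.toSubring ∧ A ≤ A' ∧ A'.FG ∧
    ∃ (_ : IsRegularLocalRing (locAtCentre A'.toSubring O)) (c : Fin p → K), (∃ j : Fin p, (j : ℕ) ≠ 0 ∧ c j ≠ 0) ∧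
    ((∃ (d m : ℕ) (hmd : m ≤ d) (t : Fin d → ↥(locAtCentre A'.toSubring O)) (a : Fin m → ℕ) (u : ↥(locAtCentre A'.toSubring O)), IsUnit u ∧
    Ideal.span (Set.range t) = IsLocalRing.maximalIdeal ↥(locAtCentre A'.toSubring O) ∧
    ringKrullDim ↥(locAtCentre A'.toSubring O) = (d : WithBot ℕ∞) ∧ 0 < m ∧ (∀ i, ¬ p ∣ a i) ∧
    (∑ j : Fin p, c j ^ p * g₀ ^ (j : ℕ)) = (u : K) * ∏ i : Fin m, ((t (Fin.castLE hmd i) : ↥(locAtCentre A'.toSubring O)) : K) ^ (a i)) ∨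
    (∃ u : ↥(locAtCentre A'.toSubring O), IsUnit u ∧ (∑ j : Fin p, c j ^ p * g₀ ^ (j : ℕ)) = (u : K) ∧
    ∀ c' : ↥(locAtCentre A'.toSubring O), u - c' ^ p ∉ IsLocalRing.maximalIdeal ↥(locAtCentre A'.toSubring O)) ∨
    (∃ s c' : ↥(locAtCentre A'.toSubring O), (∑ j : Fin p, c j ^ p * g₀ ^ (j : ℕ)) = (s : K) ∧
    s - c' ^ p ∈ IsLocalRing.maximalIdeal ↥(locAtCentre A'.toSubring O) ∧
    s - c' ^ p ∉ IsLocalRing.maximalIdeal ↥(locAtCentre A'.toSubring O) ^ 2)))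
    (hZ : ∀ d : ℕ, 4 ≤ d → ∀ (p : ℕ), p.Prime → ∀ (k K : Type) [Field k] [CharP k p] [Field K] [Algebra k K]
    [Algebra.EssFiniteType k K],
    Algebra.trdeg k K = d → ∀ (g₀ : K) (M₁ M₂ : ProjModel k K) (U₁ : M₁.X.Opens) (U₂ : M₂.X.Opens),
    (∀ x ∈ U₁, ModelCleanRegAt p g₀ M₁ x) → (∀ x ∈ U₂, ModelCleanRegAt p g₀ M₂ x) →
    ∃ (N : ProjModel k K) (φ₁ : N.Hom M₁) (φ₂ : N.Hom M₂),
    (∀ y : N.X, φ₁.f y ∈ U₁ → ModelCleanRegAt p g₀ N y) ∧ (∀ y : N.X, φ₂.f y ∈ U₂ → ModelCleanRegAt p g₀ N y)) :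
    ∀ p : ℕ, p.Prime → ∀ (k : Type) [Field k] [CharP k p] (W : AlgebraicGeometry.Scheme.{0}) [AlgebraicGeometry.IsIntegral W] (f : W ⟶ AlgebraicGeometry.Spec (.of k)) (L : Type) [Field L] [Algebra W.functionField L], AlgebraicGeometry.IsSeparated f → AlgebraicGeometry.LocallyOfFiniteType f → AlgebraicGeometry.QuasiCompact f → Literature.AlgebraicGeometry.Resolution.Scheme.IsRegular W → IsPurelyInseparable W.functionField L → Module.finrank W.functionField L = p → ¬ topologicalKrullDim W ≤ 3 → ∃ (V : AlgebraicGeometry.Scheme.{0}) (π : V ⟶ W) (_ : AlgebraicGeometry.IsIntegral V) (_ : AlgebraicGeometry.IsDominant π), AlgebraicGeometry.IsProper π ∧ Literature.AlgebraicGeometry.Resolution.IsBirational π ∧ Literature.AlgebraicGeometry.Resolution.Scheme.IsRegular V ∧ (∀ v : V, (∃ (y : L) (g : W.functionField), y ∉ Set.range (algebraMap W.functionField L) ∧ algebraMap W.functionField L g = y ^ p ∧ ((∃ (d m : ℕ) (hmd : m ≤ d) (t : Fin d → V.presheaf.stalk v) (a : Fin m → ℕ), Ideal.span (Set.range t) =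 IsLocalRing.maximalIdeal (V.presheaf.stalk v) ∧ ringKrullDim (V.presheaf.stalk v) = (d : WithBot ℕ∞) ∧ 0 < m ∧ (∀ i, ¬ p ∣ a i) ∧ Literature.AlgebraicGeometry.Motives.RatFn.functionFieldMap π g = ∏ i : Fin m, (algebraMap (V.presheaf.stalk v) V.functionField (t (Fin.castLE hmd i))) ^ (a i)) ∨ (∃ u₀ : V.presheaf.stalk v, IsUnit u₀ ∧ Literature.AlgebraicGeometry.Motives.RatFn.functionFieldMap π g = algebraMap (V.presheaf.stalk v) V.functionField u₀ ∧ ((∀ c : V.presheaf.stalk v, u₀ - c ^ p ∉ IsLocalRing.maximalIdeal (V.presheaf.stalk v)) ∨ (∃ c : V.presheaf.stalk v, u₀ - c ^ p ∈ IsLocalRing.maximalIdeal (V.presheaf.stalk v) ∧ u₀ - c ^ p ∉ IsLocalRing.maximalIdeal (V.presheaf.stalk v) ^ 2)))))) :=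
  cleanModelsDimGEFour_of_localMonomialization_coneNarrowed
    (fun d hd => localMonomialization_dim_of_resSG d (hMonoResSG d hd)) hND' hZ

end Summit.ResolutionOfSingularities.ResolutionOfSingularities.Theorems.RadicialJung.CleanModels

end
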